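import Summits.BirchSwinnertonDyer.BirchSwinnertonDyer.Theorems.SignedBaseChangeAnticyclotomicEisensteinDivisibilityAdmdefHowardVanishing
import Summits.BirchSwinnertonDyer.BirchSwinnertonDyer.Theorems.SignedBaseChangeAnticyclotomicEisensteinDivisibilityAdmdefUnitLambdaOfLoc
import Summits.BirchSwinnertonDyer.BirchSwinnertonDyer.Theorems.AdditiveKolyvaginRoadTwoPlaceLagrangian
import Literature.NumberTheory.GaloisRepresentations.IntegralGaloisActionProofs
import Literature.NumberTheory.GaloisRepresentations.DecompositionGroupOfCompletion
import HarnessLib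

/-!
# Line `admdef` (crux `AnticyclotomicEisensteinDivisibility`, stmt-BirchSwinnertonDyer-20727), rigidity road: KOLYVAGIN'S THEOREM modulo `𝔪`
# AT THE ROOT for CHKLL25's signed bipartite systems — `κ_1(1)_0 ≠ 0 ⟹ Sel^ε_1(K_0, E[p]) = ℤ·κ_1(1)_0` — modulo the `±` control at `p`
# and the ramification of `E[p]` at the bad places (the two hypotheses of `…AdmdefHowardVanishing`)

LEAD seat bsd-line-sbc-p1 (gen 31), `--supports stmt-BirchSwinnertonDyer-20727` (helper; OFF the v23 composition path).  Gens 28–30 put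
ONE direction of Howard's rigidity at the root in kernel: «[NV] + rank one ⟹ `z_{0,1} ≠ 0`» (`…AdmdefHowardRigidityRoot(AllRamified)` and its
dictionaries).  THIS FILE proves the CONVERSE — Kolyvagin's theorem mod `p` in Howard's currency ([Howard2006] Thm. 2.3.7 ∕ Thm. 3.2.3 at the
vertex `1`, `k = 1`; [BertoliniDarmon2005] proof of Thm. 4.1; W. Zhang 2014 Prop. 5.4; the reading (R5) «the non-primitive locus contains
`{d ≥ 3}`» of `Lines/admdef-lead-g23.md` §5b) — from pieces ALREADY in the tree plus one new local lemma:

* §1 `resOfLe_resH1Hom_layerZero_eq_zero_of_localization_eq_zero` — **`loc_v X = 0 ⟹ res_S (T X) = 0` for every subgroup `S` of every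
  decomposition group `D_𝔓`, `𝔓 ∣ v`** (cocycle algebra: `loc_v [ψ] = 0` gives `ψ = ∂m` on `D_{𝔓₀} = res(Γ_{K_v})`
  (`decompositionSubgroup_adicCompletionPrime_eq_range`); every `𝔓 ∣ v` is `τ • 𝔓₀` (`exists_smul_eq_of_mem_primesAbove_holds`), `D_𝔓 = τ D_{𝔓₀} τ⁻¹`
  (`Ideal.decompositionSubgroup_smul`), and there `ψ = ∂(τ•m − ψ τ)`); hence `forall_mem_ordinaryAt_of_localization_eq_zero` — **a class with
  `loc_v = 0` is `ordinaryAt` every `𝔓 ∣ v`** (CHKLL25's ordinary condition = vanishing on the Frobenius subgroups `⟨φ⟩ ≤ D_𝔓`).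
* §2 `exists_zsmul_localization_sub_eq_zero_of_isAdmissiblePrime` — at the place `v` of a Bertolini–Darmon `1`-admissible `q` the KUMMER
  condition `F_v ≤ H¹(K_v, E[p])` has exactly `p` elements (AKR `natCard_kummer_eq_of_admQ`; [BertoliniDarmon2005] Lemma 2.6 «`dim H¹_fin = 1`»),
  so two Kummer classes with `loc_v X ≠ 0` satisfy `loc_v (Y − a•X) = 0` for some `a ∈ ℤ` (`zmultiples_eq_top_of_prime_card`).
* §3 ★★ `eq_zsmul_kappa_one_of_mem_signedOrdSelmerTorsion_one` — **KOLYVAGIN AT THE ROOT**: for a signed bipartite system `B` of sign `ε`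
  at level `N = N_E` on the frame (`p ≥ 5`, `ρ̄_{E,p}` onto, `K` imaginary quadratic, Heegner, `p` split, `κ` anticyclotomic), GIVEN (CTRL)
  and (RAM) verbatim as in `…AdmdefHowardVanishing`: **`κ_1(1)_0 ≠ 0 ⟹` every `c ∈ Sel^ε_1(K_0, E[p])` is `a • κ_1(1)_0`, `a ∈ ℤ`**.
  PROOF: lift `z = κ_1(1)_0` and `c` to `X, Y ∈ H¹(K, E[p])` (`T` onto); Čebotarev with the sign (`…AdmdefRootZero.exists_admissibleFrob_resOfLe_
  ne_zero`) gives a `1`-admissible `q`, `v = (q)`, `𝔓 ∣ v`, a Frobenius `φ ∈ D_𝔓 ∩ Gal(K̄/K_∞)` with `res_{⟨φ⟩} z ≠ 0`; the SECOND reciprocity law at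
  the edge `1 — q` read upwards (`…AdmdefUnitLambdaOfLoc.isUnit_constantCoeff_lam_of_unrLoc_ne_zero`) makes `λ_1(q)(0)` a unit; §1 gives
  `loc_v X ≠ 0`; `X, Y` are Kummer at the good place `v` (Gross (7.1)), so §2 gives `a` with `loc_v (Y − aX) = 0`; by §1 `c − a z` is ordinary at
  every `𝔓' ∣ v`, hence lies in `Sel^ε_q(K_0, E[p])` (transfer UP, `…AdmdefSelmerBookkeeping`), which HOWARD'S VANISHING LEMMA (`…AdmdefHowardVanishing`,
  unit `λ_1(q)(0)`) kills: `c = a z`.  NO Poitou–Tate count and no two-class Čebotarev are needed.  Also: `κ_1(1)_0 ≠ 0 ⟹ [NV]`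
  (`hasUnitLambda_of_kappa_one_ne_zero`, Čebotarev ∘ `…AdmdefUnitLambdaOfLoc.hasUnitLambda_of_root_res_ne_zero`).
The all-ramified ∕ classical-currency forms and Howard's Thm. 3.2.3 (c) at the root as an EQUIVALENCE are the sibling `…AdmdefHowardRootEquivalence`.

HONEST FRAMING: theorems only (no definition, no named fact, no `sorry`); (CTRL) and (RAM) are HYPOTHESES; nothing about the crux, the anchors (K1),
(RV₁)H without [NV], or BSD is asserted; no summit statement is proved.

References: [cite: Howard2006, Thm. 2.3.7, Lem. 2.3.3–2.3.4, Thm. 3.2.3] [cite: BertoliniDarmon2005, Lemma 2.6, Thm. 3.2, proof of Thm. 4.1]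
[cite: WZhang2014, Prop. 5.4, Lemma 7.3] [cite: CastellaEtAl2025, Thm. 7.4, Thm. 7.5, §7.2 (arXiv:2308.10474v2 pp. 29–31)]
[cite: GrossLMS1991, §7 (7.1), Prop. 9.6] [cite: NeukirchANT1999, Ch. I §9 (9.1), (9.5)] [cite: SerreGaloisCohomology1997, I §2.4–2.5].
-/

-- D-0017: single-problem summit, the namespace repeats the problem name by design.
set_option linter.dupNamespace false
set_option autoImplicit false

noncomputable section

open scoped Classical NumberField Pointwise

namespace Summit.BirchSwinnertonDyer.BirchSwinnertonDyer.Theorems.SignedBaseChangeAcDivAdmdefKolyvaginRoot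

open CategoryTheory WeierstrassCurve NumberField IsDedekindDomain Field Module
open Literature.NumberTheory.EllipticCurves Literature.NumberTheory.GaloisRepresentations
open Literature.NumberTheory.EllipticCurves.CastellaHsuKunduLeeLiu2025
open Literature.NumberTheory.EllipticCurves.BertoliniDarmon2005
open Literature.NumberTheory.EllipticCurves.AcSigned
open Summit.BirchSwinnertonDyer.BirchSwinnertonDyer.Theorems.AdditiveKoly
open Summit.BirchSwinnertonDyer.Rank1Residual.X11b.Three.Koly.Method2
open Summit.BirchSwinnertonDyer.BirchSwinnertonDyer.Theorems.SignedBaseChangeAcDivAdmdefCoreRootOfSeenAnchor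
open Summit.BirchSwinnertonDyer.BirchSwinnertonDyer.Theorems.SignedBaseChangeAcDivAdmdefRootZero
open Summit.BirchSwinnertonDyer.BirchSwinnertonDyer.Theorems.SignedBaseChangeAcDivAdmdefUnitLambdaOfLoc
open Summit.BirchSwinnertonDyer.BirchSwinnertonDyer.Theorems.SignedBaseChangeAcDivAdmdefSelmerBookkeeping
open Summit.BirchSwinnertonDyer.BirchSwinnertonDyer.Theorems.SignedBaseChangeAcDivAdmdefLayerZeroDictionary
open Summit.BirchSwinnertonDyer.BirchSwinnertonDyer.Theorems.SignedBaseChangeAcDivAdmdefHowardVanishing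
open scoped ContRepresentation

universe u

/-! ## §1 LOCALLY TRIVIAL at `v` ⟹ trivial on every decomposition group above `v` ⟹ ORDINARY at every `𝔓 ∣ v` -/

section LocallyTrivial

variable {K : Type} [Field K] [NumberField K] (W : WeierstrassCurve ℚ) {p : ℕ} [Fact p.Prime] (κ : ZpExtension K p)

/-- **`loc_v X = 0 ⟹ res_S (T X) = 0` for every subgroup `S` of every decomposition group `D_𝔓`, `𝔓 ∣ v`.**  A cocycle `ψ` of `X` with
`loc_v [ψ] = 0` satisfies `ψ(res σ) = res σ • m − m` on `Γ_{K_v}`, i.e. `ψ = ∂m` on `D_{𝔓₀} = res(Γ_{K_v})` (`𝔓₀ = adicCompletionPrime K v`);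
any `𝔓 ∣ v` is `τ • 𝔓₀` for some `τ ∈ Γ_K` (transitivity), `D_𝔓 = τ D_{𝔓₀} τ⁻¹`, and the cocycle identity gives `ψ = ∂(τ • m − ψ τ)` on `D_𝔓`.
(`T` = the restriction `H¹(K, E[p]) → H¹(Γ_{K_0}, E[p])` of `…AdmdefCoreRootOfSeenAnchor`; no hypothesis on `v`.)
[cite: NeukirchANT1999, Ch. I §9 Prop. (9.1) and (9.5)] [cite: SerreGaloisCohomology1997, I §2.4–2.5] -/
theorem resOfLe_resH1Hom_layerZero_eq_zero_of_localization_eq_zero {v : HeightOneSpectrum (𝓞 K)} (X : Vp W K p)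
    (hX : galoisCohomology.localization ((W.baseChange K).torsionGaloisModule ((p ^ 1 : ℕ) : ℤ)) (Sum.inr v) 1 X = 0)
    {𝔓 : Ideal (absIntegers (𝓞 K) K)} (h𝔓 : 𝔓 ∈ v.primesAbove)
    {S : Subgroup (absoluteGaloisGroup K)} (hSD : S ≤ 𝔓.decompositionSubgroup (absoluteGaloisGroup K))
    (hS : S ≤ κ.layerSubgroup 0) :
    resOfLe (geomTorsion (W.baseChange K) ((p : ℤ) ^ 1)) hS
      (resH1Hom (Literature.NumberTheory.EllipticCurves.subgroupIncl (κ.layerSubgroup 0))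
        (AddSubgroup.inclusion (geomTorsion_natCast_pow_one W (K := K) (p := p)).le) (fun _ _ ↦ rfl) X) = 0 := by
  -- adapted from Theorems/…AdmdefLayerZeroDictionary.lean `resOfLe_inertia_resH1Hom_layerZero_eq_zero_of_localization_eq_zero`
  obtain ⟨ψ, rfl⟩ := oneCocycleClass_surjective
    (discreteTopRep (absoluteGaloisGroup K) (geomTorsion (W.baseChange K) ((p ^ 1 : ℕ) : ℤ))) X
  -- `loc_v [ψ] = [ψ ∘ res] = 0`: `ψ (res σ) = res σ • m - m`
  have hX' : galoisCohomology.res ((W.baseChange K).torsionGaloisModule ((p ^ 1 : ℕ) : ℤ)) (v.adicCompletion K) 1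
      (oneCocycleClass (discreteTopRep (absoluteGaloisGroup K) (geomTorsion (W.baseChange K) ((p ^ 1 : ℕ) : ℤ))) ψ) = 0 := hX
  rw [res_torsionGaloisModule_oneCocycleClass] at hX'
  obtain ⟨m, hm⟩ := (oneCocycleClass_eq_zero_iff _ _).mp hX'
  have hψres : ∀ σ : absoluteGaloisGroup (v.adicCompletion K),
      ψ.1 (absGaloisRestrict K (v.adicCompletion K) σ) = absGaloisRestrict K (v.adicCompletion K) σ • m - m := fun σ ↦ by
    have h := hm σ
    change ψ.1 (absGaloisRestrict K (v.adicCompletion K) σ) = absGaloisRestrict K (v.adicCompletion K) σ • m - m at h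
    exact h
  -- on `D_{𝔓₀} = range res`: `ψ d = d • m - m`
  have hD0 : ∀ d ∈ (adicCompletionPrime K v).decompositionSubgroup (absoluteGaloisGroup K), ψ.1 d = d • m - m := by
    intro d hd
    rw [decompositionSubgroup_adicCompletionPrime_eq_range] at hd
    obtain ⟨σ, hσ⟩ := hd
    have hσ' : absGaloisRestrict K (v.adicCompletion K) σ = d := hσ
    rw [← hσ']
    exact hψres σ
  -- `𝔓 = τ • 𝔓₀`
  obtain ⟨τ, hτ⟩ := HeightOneSpectrum.exists_smul_eq_of_mem_primesAbove_holds (adicCompletionPrime_mem_primesAbove K v) h𝔓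
  -- `ψ τ⁻¹ = -(τ⁻¹ • ψ τ)`
  have hinv : ψ.1 τ⁻¹ = -(τ⁻¹ • ψ.1 τ) := by
    have h := ψ.2 τ⁻¹ τ
    rw [inv_mul_cancel, contOneCocycles.apply_one, discreteTopRep_ρ_apply] at h
    -- `0 = ψ τ⁻¹ + τ⁻¹ • ψ τ`
    have h' : ψ.1 τ⁻¹ + τ⁻¹ • ψ.1 τ = 0 := h.symm
    exact eq_neg_of_add_eq_zero_left h'
  -- on `D_𝔓 = τ D_{𝔓₀} τ⁻¹`: `ψ d = d • m' - m'` with `m' = τ • m - ψ τ`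
  have hD : ∀ d ∈ 𝔓.decompositionSubgroup (absoluteGaloisGroup K), ψ.1 d = d • (τ • m - ψ.1 τ) - (τ • m - ψ.1 τ) := by
    intro d hd
    rw [← hτ, Ideal.decompositionSubgroup_smul, Subgroup.mem_smul_pointwise_iff_exists] at hd
    obtain ⟨d₀, hd₀, rfl⟩ := hd
    rw [MulAut.smul_def, MulAut.conj_apply]
    have hψd₀ : ψ.1 d₀ = d₀ • m - m := hD0 d₀ hd₀
    have e1 : (τ * d₀ * τ⁻¹) • (τ • m) = τ • d₀ • m := by
      rw [← mul_smul, inv_mul_cancel_right, mul_smul]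
    have e3 : (τ * d₀) • ψ.1 τ⁻¹ = -((τ * d₀ * τ⁻¹) • ψ.1 τ) := by
      rw [hinv, smul_neg, ← mul_smul]
    rw [ψ.2 (τ * d₀) τ⁻¹, discreteTopRep_ρ_apply, ψ.2 τ d₀, discreteTopRep_ρ_apply, hψd₀, e3, smul_sub, smul_sub, e1]
    abel
  -- restriction to `S ≤ D_𝔓`
  rw [resOfLe_resH1Hom_layerZero_eq_zero_iff]
  exact ⟨τ • m - ψ.1 τ, fun x ↦ hD x (hSD x.2)⟩

/-- **A class with `loc_v X = 0` is ORDINARY at every prime `𝔓 ∣ v`** (`ordinaryAt`: vanishing on `⟨φ⟩` for every Frobenius `φ ∈ D_𝔓`; by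
§1 the class vanishes on all of `D_𝔓`).  For `v = (q)`, `q` admissible, this is «`0 ∈ H¹_ord(K_q, E[p])`» transported to every prime above `v`.
[cite: Howard2006, §2.2, Lem. 2.2.1] [cite: CastellaEtAl2025, §7.2 (arXiv:2308.10474v2 p0030 L22–L27)] -/
theorem forall_mem_ordinaryAt_of_localization_eq_zero {v : HeightOneSpectrum (𝓞 K)} (X : Vp W K p)
    (hX : galoisCohomology.localization ((W.baseChange K).torsionGaloisModule ((p ^ 1 : ℕ) : ℤ)) (Sum.inr v) 1 X = 0) :
    ∀ 𝔓 ∈ v.primesAbove,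
      resH1Hom (Literature.NumberTheory.EllipticCurves.subgroupIncl (κ.layerSubgroup 0))
          (AddSubgroup.inclusion (geomTorsion_natCast_pow_one W (K := K) (p := p)).le) (fun _ _ ↦ rfl) X ∈
        ordinaryAt (W.baseChange K) ((p : ℤ) ^ 1) (κ.layerSubgroup 0) 𝔓 := by
  intro 𝔓 h𝔓
  rw [mem_ordinaryAt_iff]
  intro φ hφ hφD _
  exact resOfLe_resH1Hom_layerZero_eq_zero_of_localization_eq_zero W κ X hX h𝔓 (Subgroup.zpowers_le.mpr hφD)
    (Subgroup.zpowers_le.mpr hφ)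

/-- **Contrapositive at a Frobenius**: if `res_{⟨φ⟩} (T X) ≠ 0` for some `φ ∈ D_𝔓`, `𝔓 ∣ v`, then `loc_v X ≠ 0`.
[cite: Howard2006, Lem. 2.2.1] [cite: GrossLMS1991, Prop. 9.6] -/
theorem localization_ne_zero_of_resOfLe_zpowers_ne_zero {v : HeightOneSpectrum (𝓞 K)} (X : Vp W K p)
    {𝔓 : Ideal (absIntegers (𝓞 K) K)} (h𝔓 : 𝔓 ∈ v.primesAbove) {φ : absoluteGaloisGroup K}
    (hφD : φ ∈ 𝔓.decompositionSubgroup (absoluteGaloisGroup K)) (hφ : Subgroup.zpowers φ ≤ κ.layerSubgroup 0)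
    (hne : resOfLe (geomTorsion (W.baseChange K) ((p : ℤ) ^ 1)) hφ
      (resH1Hom (Literature.NumberTheory.EllipticCurves.subgroupIncl (κ.layerSubgroup 0))
        (AddSubgroup.inclusion (geomTorsion_natCast_pow_one W (K := K) (p := p)).le) (fun _ _ ↦ rfl) X) ≠ 0) :
    galoisCohomology.localization ((W.baseChange K).torsionGaloisModule ((p ^ 1 : ℕ) : ℤ)) (Sum.inr v) 1 X ≠ 0 :=
  fun h0 ↦ hne (resOfLe_resH1Hom_layerZero_eq_zero_of_localization_eq_zero W κ X h0 h𝔓 (Subgroup.zpowers_le.mpr hφD) hφ)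

end LocallyTrivial

/-! ## §2 The KUMMER LINE at the place of an admissible prime: `#F_v = p` -/

section KummerLine

variable {K : Type} [Field K] [NumberField K] (W : WeierstrassCurve ℚ) [W.IsElliptic] [W.IsGloballyMinimal] {p : ℕ} [Fact p.Prime]

/-- **Two Kummer classes at the place `v` of a `1`-admissible `q` are proportional there.**  The Kummer condition
`F_v = kummerSelmerStructure (p) v ≤ H¹(K_v, E[p])` has exactly `p` elements (AKR `natCard_kummer_eq_of_admQ`; [BertoliniDarmon2005] Lemma 2.6
«`H¹_fin(K_q, E[p]) ≅ 𝔽_p`»), so a non-zero element generates it (`zmultiples_eq_top_of_prime_card`): if `X, Y ∈ H¹(K, E[p])` are Kummer at `v`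
(`selmerLocalKer`) and `loc_v X ≠ 0`, then `loc_v (Y − a • X) = 0` for some `a ∈ ℤ`. [cite: BertoliniDarmon2005, Lemma 2.6] [cite: GrossLMS1991, §7 (7.1)] -/
theorem exists_zsmul_localization_sub_eq_zero_of_isAdmissiblePrime (hK : IsImaginaryQuadratic K) {q : ℕ}
    (hq : IsAdmissiblePrime (W.conductorNorm ℤ) K (fun ℓ ↦ W.frobeniusTrace ℓ) p 1 q)
    {v : HeightOneSpectrum (𝓞 K)} (hqv : ((q : ℕ) : 𝓞 K) ∈ v.asIdeal) {X Y : Vp W K p}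
    (hX : X ∈ selmerLocalKer (W.baseChange K) (v.adicCompletion K) ((p ^ 1 : ℕ) : ℤ))
    (hY : Y ∈ selmerLocalKer (W.baseChange K) (v.adicCompletion K) ((p ^ 1 : ℕ) : ℤ))
    (hX0 : galoisCohomology.localization ((W.baseChange K).torsionGaloisModule ((p ^ 1 : ℕ) : ℤ)) (Sum.inr v) 1 X ≠ 0) :
    ∃ a : ℤ, galoisCohomology.localization ((W.baseChange K).torsionGaloisModule ((p ^ 1 : ℕ) : ℤ)) (Sum.inr v) 1 (Y - a • X) = 0 := by
  set loc := galoisCohomology.localization ((W.baseChange K).torsionGaloisModule ((p ^ 1 : ℕ) : ℤ)) (Sum.inr v) 1 with hloc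
  set F := (W.baseChange K).kummerSelmerStructure ((p ^ 1 : ℕ) : ℤ) (Sum.inr v) with hF
  have hXF : loc X ∈ F := by
    rw [hF, ← AddSubgroup.mem_comap, comap_localization_kummerSelmerStructure]; exact hX
  have hYF : loc Y ∈ F := by
    rw [hF, ← AddSubgroup.mem_comap, comap_localization_kummerSelmerStructure]; exact hY
  have hcard : Nat.card F = p := natCard_kummer_eq_of_admQ W K p hK ⟨q, hq⟩ v hqv
  have hx0 : (⟨loc X, hXF⟩ : F) ≠ 0 := fun h ↦ hX0 (congrArg Subtype.val h)
  have hmem : (⟨loc Y, hYF⟩ : F) ∈ AddSubgroup.zmultiples (⟨loc X, hXF⟩ : F) :=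
    mem_zmultiples_of_prime_card hcard hx0
  obtain ⟨a, ha⟩ := AddSubgroup.mem_zmultiples_iff.mp hmem
  have ha' : a • loc X = loc Y := by
    have h := congrArg Subtype.val ha
    exact h
  refine ⟨a, ?_⟩
  have h1 : loc (Y - a • X) = loc Y - loc (a • X) := AddMonoidHom.map_sub _ Y (a • X)
  have h2 : loc (a • X) = a • loc X := AddMonoidHom.map_zsmul _ a X
  rw [h1, h2, ha', sub_self]

end KummerLine

/-! ## §3 KOLYVAGIN'S THEOREM modulo `𝔪` at the root, modulo (CTRL) and (RAM) -/

section Kolyvagin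

variable {K : Type} [Field K] [NumberField K] {W : WeierstrassCurve ℚ} [W.IsElliptic] [W.IsGloballyMinimal] {p : ℕ} [Fact p.Prime]
  {κ : ZpExtension K p} {γ : absoluteGaloisGroup K} {N : ℕ} {ε : ℤˣ} {B : SignedBipartiteSystem W K p κ}

/-- **KOLYVAGIN'S THEOREM modulo `𝔪` AT THE ROOT for a signed bipartite system, modulo the `±` control at `p` and the ramification of `E[p]`
at the bad places.**  Frame: `B` a signed bipartite system of sign `ε` at level `N = N_E` (`IsSignedBipartiteSystem`), `p ≥ 5`, `ρ̄_{E,p}` onto,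
`K` imaginary quadratic, `N_E` Heegner in `K`, `p` split, `κ` anticyclotomic; (CTRL) and (RAM) exactly as in `…AdmdefHowardVanishing`.
CONCLUSION: if the bottom class `κ_1(1)_0 ∈ H¹(Γ_{K_0}, E[p])` is NON-ZERO, then **every class of the bottom signed Selmer group
`Sel^ε_1(K_0, E[p]) = signedOrdSelmerTorsion (E/K) p κ ε 1 0 1` is an integer multiple of `κ_1(1)_0`** (so `Sel^ε_1(K_0, E[p]) = 𝔽_p · κ_1(1)_0`
is a line).  Proof in the module docstring: Čebotarev ∘ second law ∘ §1 ∘ §2 ∘ Howard's vanishing lemma at the single admissible prime `q`.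
[cite: Howard2006, Thm. 2.3.7, Lem. 2.3.3, Lem. 2.3.4, Thm. 3.2.3 (c)] [cite: BertoliniDarmon2005, proof of Thm. 4.1] [cite: WZhang2014, Prop. 5.4]
[cite: CastellaEtAl2025, Thm. 7.4 (both laws), Thm. 7.5 (arXiv:2308.10474v2 pp. 30–31)] -/
theorem eq_zsmul_kappa_one_of_mem_signedOrdSelmerTorsion_one (hB : IsSignedBipartiteSystem W K p κ γ N ε B)
    (hN : (N : ℤ) = W.conductorNorm ℤ) (h5 : 5 ≤ p) (hsurj : W.HasSurjectiveModNGaloisRep p) (hK : IsImaginaryQuadratic K)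
    (hH : SatisfiesHeegnerHypothesis (W.conductorNorm ℤ) K) (hsp : ((Ideal.span {(p : ℤ)}).primesOver (𝓞 K)).ncard = 2)
    (hκ : κ.IsAnticyclotomic)
    (hctrl : ∀ v : HeightOneSpectrum (𝓞 K), ((p : ℕ) : 𝓞 K) ∈ v.asIdeal → ∀ X : Vp W K p,
      resH1Hom (Literature.NumberTheory.EllipticCurves.subgroupIncl (κ.layerSubgroup 0))
          (AddSubgroup.inclusion (geomTorsion_natCast_pow_one W (K := K) (p := p)).le) (fun _ _ ↦ rfl) X ∈
        condAboveTorsion (W.baseChange K) p κ v (.sgn ε) 0 1 →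
      X ∈ selmerLocalKer (W.baseChange K) (v.adicCompletion K) ((p ^ 1 : ℕ) : ℤ))
    (hram : ∀ v : HeightOneSpectrum (𝓞 K), ¬ (W.baseChange K).HasGoodReductionAt v → ((p : ℕ) : 𝓞 K) ∉ v.asIdeal →
      ∃ 𝔓 ∈ v.primesAbove, ∃ τ ∈ 𝔓.inertia (absoluteGaloisGroup K), ∃ P : geomTorsion (W.baseChange K) ((p ^ 1 : ℕ) : ℤ), τ • P ≠ P)
    (hz0 : B.kappa 1 1 0 ≠ 0) :
    ∀ c ∈ signedOrdSelmerTorsion (W.baseChange K) p κ ε 1 0 1, ∃ a : ℤ, c = a • B.kappa 1 1 0 := by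
  intro c hc
  have hp : p.Prime := Fact.out
  have hN' : N = W.conductorNorm ℤ := by exact_mod_cast hN
  have hzSel : B.kappa 1 1 0 ∈ signedOrdSelmerTorsion (W.baseChange K) p κ ε 1 0 1 :=
    kappa_layer_mem_signedOrdSelmerTorsion hB one_pos (one_mem_indefProducts N K _ p 1) 0
  -- (1) lift `z = κ_1(1)_0` and `c` to `H¹(K, E[p])`
  obtain ⟨X, hX⟩ := exists_resH1Hom_layerZero_eq W κ (B.kappa 1 1 0)
  obtain ⟨Y, hY⟩ := exists_resH1Hom_layerZero_eq W κ c
  -- (2) Čebotarev with the sign: an admissible Frobenius of `Gal(K̄/K_∞)` seeing `z`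
  obtain ⟨q, hadmE, v, hqv, 𝔓, h𝔓, φ, hφ, hφD, hφF, hres⟩ :=
    exists_admissibleFrob_resOfLe_ne_zero h5 hsurj hK hH hsp κ hκ (B.kappa 1 1 0) hz0
  have hadm : IsAdmissiblePrime N K (fun ℓ ↦ W.frobeniusTrace ℓ) p 1 q := by rw [hN']; exact hadmE
  have hq : q.Prime := hadmE.1
  have hq1 : ¬ q ∣ 1 := fun h ↦ hq.ne_one (Nat.eq_one_of_dvd_one h)
  have hmq : 1 * q ∈ defProducts N K (fun ℓ ↦ W.frobeniusTrace ℓ) p 1 := by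
    rw [one_mul]; exact mem_defProducts_of_isAdmissiblePrime hadm
  -- (3) second law at the edge `1 — q`, read upwards: `λ_1(q)(0) ∈ ℤ_pˣ`
  have hlam : IsUnit (PowerSeries.constantCoeff (B.lam 1 (1 * q))) :=
    isUnit_constantCoeff_lam_of_unrLoc_ne_zero hB hmq hadm hq1 hqv h𝔓 hφ hφD hφF (a := 0) (by rwa [unrLoc_apply_zero])
  -- (4) `loc_v X ≠ 0` (§1) and both lifts are Kummer at the good place `v`
  have hlocX : galoisCohomology.localization ((W.baseChange K).torsionGaloisModule ((p ^ 1 : ℕ) : ℤ)) (Sum.inr v) 1 X ≠ 0 := by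
    refine localization_ne_zero_of_resOfLe_zpowers_ne_zero W κ X h𝔓 hφD
      ((Subgroup.zpowers_le.mpr hφ).trans (κ.kerSubgroup_le_layerSubgroup 0)) ?_
    rw [hX]; exact hres
  obtain ⟨hgoodv, hpv⟩ := hasGoodReductionAt_of_isAdmissiblePrime W K hadmE v hqv
  have hpv' : ((p : ℕ) : 𝓞 K) ∉ v.asIdeal := by rw [← Int.cast_natCast]; exact hpv
  have h𝔓₀ := adicCompletionPrime_mem_primesAbove K v
  have hno1 : ∀ w : HeightOneSpectrum (𝓞 K), ¬ ∃ ℓ : ℕ, ℓ.Prime ∧ ℓ ∣ 1 ∧ ((ℓ : ℕ) : 𝓞 K) ∈ w.asIdeal := by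
    rintro w ⟨ℓ, hℓ, hℓ1, -⟩
    exact hℓ.ne_one (Nat.dvd_one.mp hℓ1)
  have hXk : X ∈ selmerLocalKer (W.baseChange K) (v.adicCompletion K) ((p ^ 1 : ℕ) : ℤ) := by
    refine (resH1Hom_layerZero_mem_unramifiedAt_iff_mem_selmerLocalKer W κ hgoodv hpv' h𝔓₀ X).mp ?_
    rw [hX]
    exact ((mem_signedOrdSelmerTorsion_iff _).mp hzSel).2.2 v hpv' (hno1 v) _ h𝔓₀
  have hYk : Y ∈ selmerLocalKer (W.baseChange K) (v.adicCompletion K) ((p ^ 1 : ℕ) : ℤ) := by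
    refine (resH1Hom_layerZero_mem_unramifiedAt_iff_mem_selmerLocalKer W κ hgoodv hpv' h𝔓₀ Y).mp ?_
    rw [hY]
    exact ((mem_signedOrdSelmerTorsion_iff _).mp hc).2.2 v hpv' (hno1 v) _ h𝔓₀
  -- (5) the Kummer line at `v` (§2): `loc_v (Y − a X) = 0`
  obtain ⟨a, ha⟩ := exists_zsmul_localization_sub_eq_zero_of_isAdmissiblePrime W hK hadmE hqv hXk hYk hlocX
  -- (6) `c − a z ∈ Sel^ε_q(K_0, E[p])`: ordinary at every `𝔓' ∣ v` by §1, `v` being the only place above `q`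
  have hTsub : resH1Hom (Literature.NumberTheory.EllipticCurves.subgroupIncl (κ.layerSubgroup 0))
      (AddSubgroup.inclusion (geomTorsion_natCast_pow_one W (K := K) (p := p)).le) (fun _ _ ↦ rfl) (Y - a • X) =
      c - a • B.kappa 1 1 0 := by
    rw [map_sub, map_zsmul, hY, hX]
  have hmem : c - a • B.kappa 1 1 0 ∈ signedOrdSelmerTorsion (W.baseChange K) p κ ε (1 * q) 0 1 := by
    refine mem_signedOrdSelmerTorsion_of_dvd_of_forall_ordinaryAt (one_dvd _) (sub_mem hc (zsmul_mem hzSel a)) ?_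
    intro ℓ hℓ hℓq _ w hpw hℓw 𝔓' h𝔓'
    rw [one_mul] at hℓq
    have hℓq' : ℓ = q := (Nat.prime_dvd_prime_iff_eq hℓ hq).mp hℓq
    subst hℓq'
    have hwv : w = v := placesAbove_eq_of_isPrime_span K hadmE.2.2.1 hq.ne_zero hqv hℓw
    subst hwv
    rw [← hTsub]
    exact forall_mem_ordinaryAt_of_localization_eq_zero W κ (Y - a • X) ha 𝔓' h𝔓'
  -- (7) Howard's vanishing lemma at the definite vertex `q` (unit `λ_1(q)(0)`)
  have h0 := eq_zero_of_mem_signedOrdSelmerTorsion_of_isUnit_lam hB hN h5 hsurj hK hH hsp hκ hctrl hram hmq hlam _ hmem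
  exact ⟨a, (sub_eq_zero.mp h0)⟩

/-- **The rank-one INPUT of Howard's root criterion is an OUTPUT of `κ_1(1)_0 ≠ 0`**: under the hypotheses of
`eq_zsmul_kappa_one_of_mem_signedOrdSelmerTorsion_one`, the triple (`s ∈ Sel^ε_1(K_0, E[p])`, `s ≠ 0`, `Sel^ε_1(K_0, E[p]) ⊆ ℤ·s`) consumed by
`…AdmdefHowardRigidityRoot.kappa_one_layer_zero_ne_zero_of_isUnit_lam` holds with `s = κ_1(1)_0`.
[cite: Howard2006, Thm. 3.2.3 (b)–(c)] [cite: CastellaEtAl2025, Thm. 7.5 (arXiv:2308.10474v2 p0031)] -/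
theorem signedOrdSelmer_one_line_of_kappa_one_ne_zero (hB : IsSignedBipartiteSystem W K p κ γ N ε B)
    (hN : (N : ℤ) = W.conductorNorm ℤ) (h5 : 5 ≤ p) (hsurj : W.HasSurjectiveModNGaloisRep p) (hK : IsImaginaryQuadratic K)
    (hH : SatisfiesHeegnerHypothesis (W.conductorNorm ℤ) K) (hsp : ((Ideal.span {(p : ℤ)}).primesOver (𝓞 K)).ncard = 2)
    (hκ : κ.IsAnticyclotomic)
    (hctrl : ∀ v : HeightOneSpectrum (𝓞 K), ((p : ℕ) : 𝓞 K) ∈ v.asIdeal → ∀ X : Vp W K p,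
      resH1Hom (Literature.NumberTheory.EllipticCurves.subgroupIncl (κ.layerSubgroup 0))
          (AddSubgroup.inclusion (geomTorsion_natCast_pow_one W (K := K) (p := p)).le) (fun _ _ ↦ rfl) X ∈
        condAboveTorsion (W.baseChange K) p κ v (.sgn ε) 0 1 →
      X ∈ selmerLocalKer (W.baseChange K) (v.adicCompletion K) ((p ^ 1 : ℕ) : ℤ))
    (hram : ∀ v : HeightOneSpectrum (𝓞 K), ¬ (W.baseChange K).HasGoodReductionAt v → ((p : ℕ) : 𝓞 K) ∉ v.asIdeal →
      ∃ 𝔓 ∈ v.primesAbove, ∃ τ ∈ 𝔓.inertia (absoluteGaloisGroup K), ∃ P : geomTorsion (W.baseChange K) ((p ^ 1 : ℕ) : ℤ), τ • P ≠ P)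
    (hz0 : B.kappa 1 1 0 ≠ 0) :
    B.kappa 1 1 0 ∈ signedOrdSelmerTorsion (W.baseChange K) p κ ε 1 0 1 ∧ B.kappa 1 1 0 ≠ 0 ∧
      ∀ c ∈ signedOrdSelmerTorsion (W.baseChange K) p κ ε 1 0 1, ∃ a : ℤ, c = a • B.kappa 1 1 0 :=
  ⟨kappa_layer_mem_signedOrdSelmerTorsion hB one_pos (one_mem_indefProducts N K _ p 1) 0, hz0,
    eq_zsmul_kappa_one_of_mem_signedOrdSelmerTorsion_one hB hN h5 hsurj hK hH hsp hκ hctrl hram hz0⟩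

/-- **`κ_1(1)_0 ≠ 0` also yields [NV]** (Čebotarev ∘ second law at the root: `…AdmdefRootZero.exists_admissibleFrob_resOfLe_ne_zero` ∘
`…AdmdefUnitLambdaOfLoc.hasUnitLambda_of_root_res_ne_zero`), on the frame alone (no (CTRL)/(RAM)) — the [NV] half of the root equivalence of the sibling file.
[cite: CastellaEtAl2025, Thm. 7.4 second law, Thm. 7.5] [cite: Howard2006, Thm. 3.2.3 (c)] -/
theorem hasUnitLambda_of_kappa_one_ne_zero (hB : IsSignedBipartiteSystem W K p κ γ N ε B)
    (hN : (N : ℤ) = W.conductorNorm ℤ) (h5 : 5 ≤ p) (hsurj : W.HasSurjectiveModNGaloisRep p) (hK : IsImaginaryQuadratic K)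
    (hH : SatisfiesHeegnerHypothesis (W.conductorNorm ℤ) K) (hsp : ((Ideal.span {(p : ℤ)}).primesOver (𝓞 K)).ncard = 2)
    (hκ : κ.IsAnticyclotomic) (hz0 : B.kappa 1 1 0 ≠ 0) : B.HasUnitLambda N := by
  have hN' : N = W.conductorNorm ℤ := by exact_mod_cast hN
  obtain ⟨q, hadmE, v, hqv, 𝔓, h𝔓, φ, hφ, hφD, hφF, hres⟩ :=
    exists_admissibleFrob_resOfLe_ne_zero h5 hsurj hK hH hsp κ hκ (B.kappa 1 1 0) hz0
  have hadm : IsAdmissiblePrime N K (fun ℓ ↦ W.frobeniusTrace ℓ) p 1 q := by rw [hN']; exact hadmE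
  exact (hasUnitLambda_of_root_res_ne_zero hB hadm hqv h𝔓 hφ hφD hφF hres).2

end Kolyvagin

end Summit.BirchSwinnertonDyer.BirchSwinnertonDyer.Theorems.SignedBaseChangeAcDivAdmdefKolyvaginRoot

end
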